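import Summits.BirchSwinnertonDyer.BirchSwinnertonDyer.Theorems.ResidualThetaTransportAtTwoThetaLayerLambdaCongruenceAtTwoSdTorsionFrickePeriods
import Literature.NumberTheory.EllipticCurves.ModularJacobianModPMultiplicityOne
import HarnessLib

/-!
# Crux Kan⁺ `ThetaLayerLambdaCongruenceAtTwo` (stmt-BirchSwinnertonDyer-20688), SD floor, sub-brick (W) of S6, packaged —
# the Fricke involution as an additive endomorphism of the `𝕋_ℤ`-module `Λ = periodHomologyHecke L`
# (width seat bsd-wall-rtt-p3-w4 g6; `--supports stmt-BirchSwinnertonDyer-20688`; THEOREMS ONLY, no `def`, no `sorry`;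
# BSD is not proved by any of this)

The SD₂ assembly of the lead (`…SdTwoInterface`, `sdTwo_of_twistedAdjointPairing`, p653335) takes as data an
additive `w : periodHomologyHecke L →+ periodHomologyHecke L` with `w ∘ w ≡ id` and `w T_p ≡ T_p w` (`p ∤ L`) modulo
`2Λ`. This file DELIVERS that datum, EXACTLY (not just modulo `2Λ`), from the analytic sub-brick
`…SdTorsionFrickePeriods` (`w_N^∨` preserves `Λ`, is an involution, commutes with `T_n^∨` for `gcd(n, N) = 1`):

* `exists_frickeHom_periodHomologyHecke`: there is `w : Λ →+ Λ` with `(w x : S₂^∨) = w_L^∨ x`, `w (w y) = y`, and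
  `w (T_p • y) = T_p • w y` for every prime `p ∤ L` (`T_p = HeckeRing0.T L 2 p`, acting on `Λ ⊆ S₂^∨` by duality);
* `exists_frickeHom_periodHomologyHecke_mod_two`: the same in the literal hypothesis shapes `hww`, `hTw` of
  `sdTwo_of_twistedAdjointPairing` (with the even error term `z + z`, `z = 0`).

What remains for the interface after this file: the pairing `Q` with its left kernel in `2Λ`, `Q(T_p x, y) = Q(x, T_p y)`
(`p ∤ L`) and `Q(U_q x, y) = Q(x, w U_q w y)` (`q ∣ L`) — bricks S4–S6 of the rtt-p3-w2 lineage.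

## References
* A. O. L. Atkin, J. Lehner, Hecke operators on `Γ₀(m)` (1970), §2, Lemmas 7 and 11 [AtkinLehner1970].
* L. Merel, Homologie des courbes modulaires affines et paramétrisations modulaires (1995), §2.3 [Merel1995Homologie].
-/

-- justification: the `Summit.BirchSwinnertonDyer.BirchSwinnertonDyer.…` path repeats a component (route-file convention)
set_option linter.dupNamespace false
set_option autoImplicit false

noncomputable section

open scoped MatrixGroups ModularForm

open CongruenceSubgroup

open Literature.NumberTheory.EllipticCurves Literature.NumberTheory.EllipticCurves.ModularForms

namespace Summit.BirchSwinnertonDyer.BirchSwinnertonDyer.Theorems.SdTorsion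

variable (L : ℕ) [NeZero L]

/-- **`T_p • φ = T_p^∨ φ` on `S₂(Γ₀(L))^∨`**: the `𝕋_ℤ`-action on the dual space is transposition
(`HeckeRing0.smul_dual_apply`, `HeckeRing0.toEnd_T`). [folklore] -/
theorem heckeRing0_T_smul_eq_dualMap (p : ℕ) (hp : p.Prime) (φ : Module.Dual ℂ (CuspForm (Gamma0 L) 2)) :
    HeckeRing0.T L 2 p hp • φ =
      (haveI : NeZero p := ⟨hp.ne_zero⟩; (heckeT (Gamma0 L) 2 p).dualMap φ) := by
  haveI : NeZero p := ⟨hp.ne_zero⟩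
  ext h
  rw [HeckeRing0.smul_dual_apply, HeckeRing0.toEnd_T, LinearMap.dualMap_apply]

/-- **The Fricke involution on the `𝕋_ℤ`-module `Λ = periodHomologyHecke L`, exactly**: an additive
`w : Λ →+ Λ` whose underlying map is the dual Fricke involution `w_L^∨` of `S₂(Γ₀(L))^∨` (which preserves `Λ`,
`dualMap_frickeInvolution_mem_periodHomology`), with `w ∘ w = id` (`w_L² = 1` in weight `2`) and
`w (T_p • y) = T_p • (w y)` for every prime `p ∤ L` (Atkin–Lehner: `w_L T_p = T_p w_L` for `p ∤ L`).
[cite: AtkinLehner1970, Lemmas 7 and 11] -/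
theorem exists_frickeHom_periodHomologyHecke :
    ∃ w : periodHomologyHecke L →+ periodHomologyHecke L,
      (∀ x : periodHomologyHecke L,
        ((w x : periodHomologyHecke L) : Module.Dual ℂ (CuspForm (Gamma0 L) 2)) =
          (frickeInvolution L 2).dualMap (x : Module.Dual ℂ (CuspForm (Gamma0 L) 2))) ∧
      (∀ y : periodHomologyHecke L, w (w y) = y) ∧
      (∀ (p : ℕ) (hp : p.Prime), ¬ p ∣ L → ∀ y : periodHomologyHecke L,
        w (HeckeRing0.T L 2 p hp • y) = HeckeRing0.T L 2 p hp • w y) := by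
  let w : periodHomologyHecke L →+ periodHomologyHecke L :=
    { toFun := fun x ↦ ⟨(frickeInvolution L 2).dualMap (x : Module.Dual ℂ (CuspForm (Gamma0 L) 2)),
        dualMap_frickeInvolution_mem_periodHomology L x.2⟩
      map_zero' := Subtype.ext (by simp)
      map_add' := fun x y ↦ Subtype.ext (by simp) }
  refine ⟨w, fun x ↦ rfl, fun y ↦ Subtype.ext ?_, fun p hp hpL y ↦ Subtype.ext ?_⟩
  · exact dualMap_frickeInvolution_dualMap_frickeInvolution L (y : Module.Dual ℂ (CuspForm (Gamma0 L) 2))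
  · haveI : NeZero p := ⟨hp.ne_zero⟩
    have hcop : p.Coprime L := (Nat.Prime.coprime_iff_not_dvd hp).mpr hpL
    change (frickeInvolution L 2).dualMap
        (((HeckeRing0.T L 2 p hp • y : periodHomologyHecke L) : Module.Dual ℂ (CuspForm (Gamma0 L) 2))) =
      HeckeRing0.T L 2 p hp • (frickeInvolution L 2).dualMap (y : Module.Dual ℂ (CuspForm (Gamma0 L) 2))
    rw [Submodule.coe_smul, heckeRing0_T_smul_eq_dualMap, heckeRing0_T_smul_eq_dualMap,
      dualMap_frickeInvolution_dualMap_heckeT L p hcop]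

/-- **The datum `w` of the SD₂ interface `sdTwo_of_twistedAdjointPairing`, in its literal hypothesis shapes**
(`hww : ∀ y, ∃ z, w (w y) = y + (z + z)`, `hTw : ∀ p ∤ L, ∀ y, ∃ z, w (T_p • y) = T_p • w y + (z + z)`; here with
`z = 0`), together with the identification of `w` as `w_L^∨` on `Λ`. [cite: AtkinLehner1970, Lemmas 7 and 11] -/
theorem exists_frickeHom_periodHomologyHecke_mod_two :
    ∃ w : periodHomologyHecke L →+ periodHomologyHecke L,
      (∀ x : periodHomologyHecke L,
        ((w x : periodHomologyHecke L) : Module.Dual ℂ (CuspForm (Gamma0 L) 2)) =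
          (frickeInvolution L 2).dualMap (x : Module.Dual ℂ (CuspForm (Gamma0 L) 2))) ∧
      (∀ y : periodHomologyHecke L, ∃ z : periodHomologyHecke L, w (w y) = y + (z + z)) ∧
      (∀ (p : ℕ) (hp : p.Prime), ¬ p ∣ L → ∀ y : periodHomologyHecke L, ∃ z : periodHomologyHecke L,
        w (HeckeRing0.T L 2 p hp • y) = HeckeRing0.T L 2 p hp • w y + (z + z)) := by
  obtain ⟨w, hw, hww, hTw⟩ := exists_frickeHom_periodHomologyHecke L
  exact ⟨w, hw, fun y ↦ ⟨0, by rw [hww, add_zero, add_zero]⟩,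
    fun p hp hpL y ↦ ⟨0, by rw [hTw p hp hpL, add_zero, add_zero]⟩⟩

/-- **`w` maps period functionals to period functionals of Fricke conjugates, on `Λ`**: for any `w` as in
`exists_frickeHom_periodHomologyHecke` (i.e. with underlying map `w_L^∨`) and `γ, γ' ∈ Γ₀(L)` with
`w_L ∘ γ = γ' ∘ w_L` on `ℍ`, `w {∞, γ∞} = {∞, γ'∞}`. [cite: Merel1995Homologie, §2.3] -/
theorem frickeHom_periodFunctional (w : periodHomologyHecke L →+ periodHomologyHecke L)
    (hw : ∀ x : periodHomologyHecke L,
      ((w x : periodHomologyHecke L) : Module.Dual ℂ (CuspForm (Gamma0 L) 2)) =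
        (frickeInvolution L 2).dualMap (x : Module.Dual ℂ (CuspForm (Gamma0 L) 2)))
    (γ γ' : Gamma0 L)
    (hconj : ∀ τ : UpperHalfPlane, glCast (frickeGL L : GL (Fin 2) ℚ) • ((γ : SL(2, ℤ)) • τ) =
      (γ' : SL(2, ℤ)) • (glCast (frickeGL L : GL (Fin 2) ℚ) • τ)) :
    w ⟨periodFunctional L γ, periodFunctional_mem_periodHomology L γ⟩ =
      ⟨periodFunctional L γ', periodFunctional_mem_periodHomology L γ'⟩ := by
  apply Subtype.ext
  rw [hw]
  exact dualMap_frickeInvolution_periodFunctional L γ γ' hconj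

end Summit.BirchSwinnertonDyer.BirchSwinnertonDyer.Theorems.SdTorsion

end
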